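import Summits.BirchSwinnertonDyer.BirchSwinnertonDyer.Theorems.GoldfeldAllTwistsTwoConverseTwinAdditiveSplitPrimeTwistSelmer
import Summits.BirchSwinnertonDyer.BirchSwinnertonDyer.Theorems.GoldfeldAllTwistsTwoConverseTwinAdditiveInertTwistDescent
import HarnessLib

set_option linter.dupNamespace false -- namespace `…BirchSwinnertonDyer.BirchSwinnertonDyer…` is the cell's (D-0017 nested layout)
set_option autoImplicit false

/-!
# Twin″ (item 19140), X: the twists `49a1^{(−2ℓ)}`, `ℓ ≡ 3 (mod 8)` prime INERT in `ℚ(√−7)` —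
# Selmer orders `#S ≤ 2`, `#S' ≤ 4`; hence `rank ≤ 1`, `Ш[2] = 0` in rank one, twin″ ⟺ a unit statement

Cell `bsd-goldfeld`, seat `bsd-goldfeld-s1p-c301` (gen 2); `--supports stmt-BirchSwinnertonDyer-19140`. Parts
III/VI treated `49a1^{(−2ℓ)}` for inert `ℓ ≡ 1 (mod 4)` (`S ⊆ {1,2,7,14}`, `S' ⊆ {1,−7}`). For inert
`ℓ ≡ 3 (mod 8)` (`ℓ = 3, 19, 59, 83, …`; the third additive base family `B₂ = 49a1^{(2)}` twisted by `−ℓ`)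
the shape flips — numerically `S = {1,7}`, `S' = {1,2,−7,−14}` — and we bound the ORDERS
(`E_{−2ℓ} : y² = x³ − 42ℓ x² + 448ℓ² x`; `S = S(−42ℓ, 448ℓ²)`, `S' = S(84ℓ, −28ℓ²)`; both are `2`-groups,
Silverman X.4.9, tree `exists_card_twoIsogenySelmerGroup(')_eq_two_pow`):

* `card_twoIsogenySelmerGroup_twoInertThreeTwist_le`: **`#S ≤ 2`** — `S ⊆ {1, 7, 14}`: the real place;
  the prime `ℓ` kills the classes divisible by `ℓ` (part I's `not_isSoluble_padic_of_prime_dvd_coeffs`,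
  reduced discriminant `−7·2²`) and the class `2` (part VIII's `not_isSoluble_padic_of_nonresidue_of_sq_dvd`:
  `2` and `224 = 16·14` are non-residues, as `(2/ℓ) = −1` for `ℓ ≡ 3 (mod 8)` and `(7/ℓ) = +1`).
* `card_twoIsogenySelmerGroup'_twoInertThreeTwist_le`: **`#S' ≤ 4`** — `S' ⊆ {1, 2, −7, −14, −2ℓ, 7ℓ, 14ℓ}`:
  by quadratic reciprocity `ℓ` is a NON-residue mod `7` (`(ℓ/7) = −(7/ℓ) = −1`), so at the prime `7`
  (`7 ∥ 7168ℓ²`, Zywina's `isSquare_zmod_of_isSoluble_padic`) the eight classes `−1, −2, 7, 14, ℓ, 2ℓ,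
  −7ℓ, −14ℓ` die, and the class `−ℓ` dies at `2` (`not_isSoluble_two_twoInertThree`, residues mod `32`,
  `decide`).
* `rank_le_one_and_sha_two_twoInertThreeTwist`, `bsdp_two_iff_shaAn_unit_twoInertThreeTwist`: for every
  model `W` of `49a1^{(−2ℓ)}`: `rank W(ℚ) ≤ 1` UNCONDITIONALLY, `rank = 1 ⇒ Ш(W)[2] = 0`; with GZK and
  `r_an = 1`: `Ш(W)[2^∞] = 0`, `corank_{ℤ₂} Sel_{2^∞}(W) = 1`, `BSD(W,2) ⟺ ∃ q : ℚ, #Ш_an(W) = q ∧ ord₂ q = 0`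
  (part VII's `rank_le_one_and_sha_parts_of_card_mul_le`, `#S·#S' ≤ 8`).

Numerically (gen-0 kit tables, `|d| ≤ 3000`): all such twists have analytic rank `1`; every resolved one has
`Ш[2] = 0`, `#Ш_an = 1`. Inert `ℓ ≡ 7 (mod 8)` is NOT treated (the class `2 ∈ S` then dies only at `2`, by
a valuation argument not formalised here). HONEST FRAMING: no `BSD(W,2)` is proved; BSD is not proved by
any of this.

References: Silverman, *AEC* (2009), X.4.2(a), X.4.9 [SilvermanAEC2009]; Zywina, arXiv:2502.01957, Lemma 3.1
[Zywina2025]; Miller, LMS JCM 14 (2011), Def. 1.1 [Miller2011LMS].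
-/

noncomputable section

open scoped Classical

open WeierstrassCurve Literature.NumberTheory.EllipticCurves
open Literature.NumberTheory.EllipticCurves.Zywina2025 (exists_padicInt_of_isSoluble
  isSquare_zmod_of_isSoluble_padic)

namespace Summit.BirchSwinnertonDyer.BirchSwinnertonDyer.Theorems.GoldfeldGoodTwists

/-! ## §1. Inputs: residues mod `ℓ`, mod `7`, and the `2`-adic class `−ℓ` -/

/-- For `ℓ ≡ 3 (mod 8)` with `(−7/ℓ) = −1`: `2` and `224` are non-residues mod `ℓ`, and `(7/ℓ) = +1`.
[folklore] -/
private theorem residues_mod_l {l : ℕ} [Fact l.Prime] (hl8 : l % 8 = 3) (hl7 : legendreSym l (-7) = -1) :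
    ¬ IsSquare ((2 : ℤ) : ZMod l) ∧ ¬ IsSquare ((224 : ℤ) : ZMod l) ∧ legendreSym l 7 = 1 := by
  have hl2 : l ≠ 2 := by rintro rfl; norm_num at hl8
  have h2 : legendreSym l 2 = -1 := by
    rw [legendreSym.at_two hl2, ZMod.χ₈_nat_eq_if_mod_eight]
    simp [hl8, show l % 2 = 1 by omega]
  have hm1 : legendreSym l (-1) = -1 := by
    rw [legendreSym.at_neg_one hl2, ZMod.χ₄_nat_three_mod_four (by omega)]
  have h7 : legendreSym l 7 = 1 := by
    have hmul : legendreSym l (-7) = legendreSym l (-1) * legendreSym l 7 := by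
      rw [← legendreSym.mul]; norm_num
    rw [hmul, hm1] at hl7
    linarith
  have h20 : ((2 : ℤ) : ZMod l) ≠ 0 := by
    intro h
    have : ((2 : ℕ) : ZMod l) = 0 := by exact_mod_cast h
    rw [ZMod.natCast_eq_zero_iff] at this
    exact hl2 ((Nat.prime_dvd_prime_iff_eq Fact.out Nat.prime_two).mp this)
  have h40 : ((4 : ℤ) : ZMod l) ≠ 0 := by
    have : ((4 : ℤ) : ZMod l) = ((2 : ℤ) : ZMod l) * ((2 : ℤ) : ZMod l) := by push_cast; norm_num
    rw [this]; exact mul_ne_zero h20 h20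
  have h16 : legendreSym l 16 = 1 := by
    rw [show (16 : ℤ) = 4 ^ 2 by norm_num]; exact legendreSym.sq_one' l h40
  refine ⟨(legendreSym.eq_neg_one_iff l).mp h2, (legendreSym.eq_neg_one_iff l).mp ?_, h7⟩
  rw [show (224 : ℤ) = 16 * (2 * 7) by norm_num, legendreSym.mul, legendreSym.mul, h16, h2, h7]
  norm_num

/-- For `ℓ ≡ 3 (mod 4)` inert: `ℓ` is a NON-residue mod `7` (`(ℓ/7) = −(7/ℓ) = −1` by reciprocity), and the
non-residue table mod `7` used at the prime `7`. [folklore] -/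
private theorem zmod_seven_table : ∀ x : ZMod 7, (x = 3 ∨ x = 5 ∨ x = 6) →
    ∀ r : ZMod 7, r * r ≠ -1 ∧ r * r ≠ -2 ∧ r * r ≠ x ∧ r * r ≠ 2 * x ∧ r * r ≠ 4 * x ∧
      r * r ≠ -4 * x ^ 2 ∧ r * r ≠ -2 * x ^ 2 := by
  decide

/-- The nonzero non-residues mod `7` are `3, 5, 6`. [folklore] -/
private theorem zmod_seven_nonresidue_cases : ∀ x : ZMod 7, x ≠ 0 → x ≠ 1 * 1 → x ≠ 2 * 2 → x ≠ 3 * 3 →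
    (x = 3 ∨ x = 5 ∨ x = 6) := by
  decide

/-- `ℓ ≡ 3 (mod 8)` inert, `ℓ ≠ 7`: `ℓ` is a nonzero NON-residue mod `7` (`(ℓ/7) = −(7/ℓ) = −1`).
[folklore] -/
private theorem l_nonresidue_mod_seven {l : ℕ} [Fact l.Prime] (hl8 : l % 8 = 3)
    (hl7 : legendreSym l (-7) = -1) (hl7' : l ≠ 7) :
    ((l : ℤ) : ZMod 7) ≠ 0 ∧ ∀ q : ZMod 7, q * q ≠ (l : ZMod 7) := by
  haveI : Fact (Nat.Prime 7) := ⟨by norm_num⟩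
  have hl07 : ((l : ℤ) : ZMod 7) ≠ 0 := by
    rw [Ne, ZMod.intCast_zmod_eq_zero_iff_dvd]
    intro h
    exact hl7' ((Nat.prime_dvd_prime_iff_eq (by norm_num) Fact.out).mp (by exact_mod_cast h)).symm
  refine ⟨hl07, ?_⟩
  have h7l : legendreSym 7 l = -1 := by
    rw [legendreSym.quadratic_reciprocity_three_mod_four (by omega) (by norm_num)]
    have := (residues_mod_l hl8 hl7).2.2
    push_cast at this ⊢
    linarith
  have hns : ¬ IsSquare (((l : ℤ)) : ZMod 7) := (legendreSym.eq_neg_one_iff 7).mp h7l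
  intro q hq
  exact hns ⟨q, by push_cast; rw [hq]⟩

/-- The finite check behind the `2`-adic lemma: for `x ≡ 3 (mod 8)` in `ℤ/32`, neither
`x(−1 + 84T² + 28T⁴)` nor `x(28 + 84T² − T⁴)` is a square. [folklore] -/
private theorem zmod_thirtytwo_key' : ∀ x : ZMod 32, (x = 3 ∨ x = 11 ∨ x = 19 ∨ x = 27) →
    ∀ T S : ZMod 32, S ^ 2 ≠ x * (-1 + 84 * T ^ 2 + 28 * T ^ 4) ∧
      S ^ 2 ≠ x * (28 + 84 * T ^ 2 - T ^ 4) := by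
  decide

/-- **`2`-adic lemma**: for `ℓ ≡ 3 (mod 8)` the class `−ℓ` of `S(84ℓ, −28ℓ²)`, i.e.
`w² = −ℓ u⁴ + 84ℓ u²z² + 28ℓ z⁴`, has no non-trivial `ℚ₂`-point (read modulo `32` in a `ℤ₂`-chart).
[cite: SilvermanAEC2009, Prop. X.4.9 and Example X.4.10] -/
theorem not_isSoluble_two_twoInertThree {l : ℕ} (hl8 : l % 8 = 3) :
    ¬ ((twoIsogenyQuartic (84 * l) (-l) (28 * l)).map (Int.castRingHom ℚ_[2])).IsSoluble := by
  haveI : Fact (Nat.Prime 2) := ⟨Nat.prime_two⟩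
  intro h
  obtain ⟨f, f', hff, t, s, hs⟩ := exists_padicInt_of_isSoluble h
  have hx : (l : ZMod 32) = 3 ∨ (l : ZMod 32) = 11 ∨ (l : ZMod 32) = 19 ∨ (l : ZMod 32) = 27 := by
    have h : l % 32 = 3 ∨ l % 32 = 11 ∨ l % 32 = 19 ∨ l % 32 = 27 := by omega
    rw [← ZMod.natCast_mod l 32]
    rcases h with h | h | h | h <;> rw [h] <;> norm_num
  rcases hff with ⟨rfl, rfl⟩ | ⟨rfl, rfl⟩
  · have h2 := congrArg (PadicInt.toZModPow 5 : ℤ_[2] →+* ZMod (2 ^ 5)) hs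
    simp only [map_pow, map_add, map_mul, map_intCast] at h2
    push_cast at h2
    exact (zmod_thirtytwo_key' (l : ZMod 32) hx (PadicInt.toZModPow 5 t) (PadicInt.toZModPow 5 s)).1
      (by rw [h2]; ring)
  · have h2 := congrArg (PadicInt.toZModPow 5 : ℤ_[2] →+* ZMod (2 ^ 5)) hs
    simp only [map_pow, map_add, map_mul, map_intCast] at h2
    push_cast at h2
    exact (zmod_thirtytwo_key' (l : ZMod 32) hx (PadicInt.toZModPow 5 t) (PadicInt.toZModPow 5 s)).2
      (by rw [h2]; ring)

/-! ## §2. The Selmer orders -/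

/-- **`#S(−42ℓ, 448ℓ²) ≤ 2`** for a prime `ℓ ≡ 3 (mod 8)` with `(−7/ℓ) = −1` (`S ⊆ {1, 7, 14}`, `#S = 2^k`).
[cite: SilvermanAEC2009, Prop. X.4.9 and Example X.4.10] -/
theorem card_twoIsogenySelmerGroup_twoInertThreeTwist_le {l : ℕ} [Fact l.Prime] (hl8 : l % 8 = 3)
    (hl7 : legendreSym l (-7) = -1) :
    (twoIsogenySelmerGroup (-42 * l) (448 * l ^ 2)).card ≤ 2 := by
  have hl : l.Prime := Fact.out
  have hlp : Prime (l : ℤ) := Nat.prime_iff_prime_int.mp hl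
  have hl0 : (l : ℤ) ≠ 0 := by exact_mod_cast hl.ne_zero
  have hl2 : l ≠ 2 := by rintro rfl; norm_num at hl8
  have hb : (448 * l ^ 2 : ℤ) ≠ 0 := by positivity
  obtain ⟨h2, h224, -⟩ := residues_mod_l hl8 hl7
  have h20 : ((2 : ℤ) : ZMod l) ≠ 0 := by
    intro h
    have : ((2 : ℕ) : ZMod l) = 0 := by exact_mod_cast h
    rw [ZMod.natCast_eq_zero_iff] at this
    exact hl2 ((Nat.prime_dvd_prime_iff_eq hl Nat.prime_two).mp this)
  have hsub : twoIsogenySelmerGroup (-42 * l) (448 * l ^ 2) ⊆ ({1, 7, 14} : Finset ℤ) := by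
    intro d hd
    rw [mem_twoIsogenySelmerGroup_iff hb] at hd
    obtain ⟨hsqf, ⟨d', hdd'⟩, hloc⟩ := hd
    have hd'eq : (448 * l ^ 2 : ℤ) / d = d' := by
      rw [hdd', Int.mul_ediv_cancel_left _ hsqf.ne_zero]
    rw [hd'eq] at hloc
    obtain ⟨hreal, hpadic⟩ := hloc
    have hdpos : 0 < d := by
      rcases lt_or_gt_of_ne hsqf.ne_zero with hneg | hpos
      · exfalso
        have hbpos : (0 : ℤ) < 448 * (l : ℤ) ^ 2 := by positivity
        have hd'neg : d' < 0 := by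
          by_contra hcon
          nlinarith [mul_nonpos_iff.mpr (Or.inr ⟨hneg.le, le_of_not_gt hcon⟩)]
        have ha : (-42 * (l : ℤ)) ≤ 0 := by
          have : (0 : ℤ) ≤ l := by positivity
          linarith
        exact not_isSoluble_real_twoIsogenyQuartic_of_neg hneg hd'neg ha hreal
      · exact hpos
    have hld : ¬ (l : ℤ) ∣ d := by
      rintro ⟨e, rfl⟩
      have h1 : e * d' = 448 * l := mul_left_cancel₀ hl0 (by linear_combination (-1 : ℤ) * hdd')
      have h3 : (l : ℤ) ∣ e * d' := ⟨448, by rw [h1]; ring⟩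
      rcases hlp.dvd_or_dvd h3 with h4 | h4
      · obtain ⟨e₁, rfl⟩ := h4
        exact hlp.not_unit (hsqf (l : ℤ) ⟨e₁, by ring⟩)
      · obtain ⟨e', rfl⟩ := h4
        have hm : e * e' = 448 := mul_left_cancel₀ hl0 (by linear_combination h1)
        have hns : ¬ IsSquare ((((-42) ^ 2 - 4 * 448 : ℤ)) : ZMod l) := by
          rw [show ((-42 : ℤ) ^ 2 - 4 * 448 : ℤ) = -7 * 2 ^ 2 by norm_num]
          exact not_isSquare_mul_sq_zmod h20 ((legendreSym.eq_neg_one_iff l).mp hl7)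
        exact not_isSoluble_padic_of_prime_dvd_coeffs (p := l) (c := -42) (by ring) rfl rfl hm hns
          (hpadic l)
    have hne2 : d ≠ 2 := by
      rintro rfl
      have hd'1 : d' = (l : ℤ) ^ 2 * 224 := by linarith
      exact not_isSoluble_padic_of_nonresidue_of_sq_dvd (p := l) (c := -42) (e' := 224) (by ring)
        hd'1 h2 h224 (hpadic l)
    have h0 : d ∣ 448 * (l : ℤ) ^ 2 := ⟨d', hdd'⟩
    have h1 : d ∣ (14 * (l : ℤ)) ^ 6 := h0.trans ⟨16807 * (l : ℤ) ^ 4, by ring⟩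
    have h14l : d ∣ 14 * (l : ℤ) := (hsqf.dvd_pow_iff_dvd (by norm_num)).mp h1
    have hcop : IsCoprime d (l : ℤ) := ((hlp.irreducible.coprime_iff_not_dvd).mpr hld).symm
    have h14 : d ∣ 14 := hcop.dvd_of_dvd_mul_right h14l
    have hle : d ≤ 14 := Int.le_of_dvd (by norm_num) h14
    interval_cases d <;> first | (exfalso; omega) | simp
  have hab := hab_inertTwoTwist hl.pos
  obtain ⟨k, hk⟩ := exists_card_twoIsogenySelmerGroup_eq_two_pow hab
  have hle3 : (twoIsogenySelmerGroup (-42 * l) (448 * l ^ 2)).card ≤ 3 :=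
    (Finset.card_le_card hsub).trans Finset.card_le_three
  rw [hk] at hle3 ⊢
  have hk2 : k < 2 := (Nat.pow_lt_pow_iff_right one_lt_two).mp (lt_of_le_of_lt hle3 (by norm_num))
  calc 2 ^ k ≤ 2 ^ 1 := Nat.pow_le_pow_right two_pos (by omega)
    _ = 2 := by norm_num

/-- **`#S'(−42ℓ, 448ℓ²) = #S(84ℓ, −28ℓ²) ≤ 4`** for a prime `ℓ ≡ 3 (mod 8)` with `(−7/ℓ) = −1`:
`S' ⊆ {1, 2, −7, −14, −2ℓ, 7ℓ, 14ℓ}` (eight classes die at `7`, where `ℓ` is a non-residue; `−ℓ` dies at `2`),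
and `#S'` is a power of `2`. [cite: SilvermanAEC2009, Prop. X.4.9] [cite: Zywina2025, Lemma 3.1 (proof)] -/
theorem card_twoIsogenySelmerGroup'_twoInertThreeTwist_le {l : ℕ} [Fact l.Prime] (hl8 : l % 8 = 3)
    (hl7 : legendreSym l (-7) = -1) :
    (twoIsogenySelmerGroup' (-42 * l) (448 * l ^ 2)).card ≤ 4 := by
  have hl : l.Prime := Fact.out
  haveI : Fact (Nat.Prime 7) := ⟨by norm_num⟩
  have hlp : Prime (l : ℤ) := Nat.prime_iff_prime_int.mp hl
  have hl0 : (l : ℤ) ≠ 0 := by exact_mod_cast hl.ne_zero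
  have hlpos : (0 : ℤ) < l := by exact_mod_cast hl.pos
  have hl7' : l ≠ 7 := by rintro rfl; norm_num at hl8
  obtain ⟨hl07, hlns⟩ := l_nonresidue_mod_seven hl8 hl7 hl7'
  have hl07' : (l : ZMod 7) ≠ 0 := by exact_mod_cast hl07
  have htab := zmod_seven_table (l : ZMod 7)
    (zmod_seven_nonresidue_cases _ hl07' (hlns 1).symm (hlns 2).symm (hlns 3).symm)
  have hA : (-2 * (-42 * l : ℤ)) = 84 * l := by ring
  have hB : ((-42 * l : ℤ) ^ 2 - 4 * (448 * l ^ 2)) = -28 * l ^ 2 := by ring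
  have hb : (-28 * l ^ 2 : ℤ) ≠ 0 := mul_ne_zero (by norm_num) (pow_ne_zero 2 hl0)
  have hsub : twoIsogenySelmerGroup' (-42 * l) (448 * l ^ 2) ⊆
      ({1, 2, -7, -14, (l : ℤ) * (-2), (l : ℤ) * 7} ∪ {(l : ℤ) * 14} : Finset ℤ) := by
    intro d hd
    rw [twoIsogenySelmerGroup'_eq, hA, hB, mem_twoIsogenySelmerGroup_iff hb] at hd
    obtain ⟨hsqf, ⟨d', hdd'⟩, hloc⟩ := hd
    have hd'eq : (-28 * l ^ 2 : ℤ) / d = d' := by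
      rw [hdd', Int.mul_ediv_cancel_left _ hsqf.ne_zero]
    rw [hd'eq] at hloc
    obtain ⟨-, hpadic⟩ := hloc
    have hdisc : ∀ x y : ℤ, x * y = -28 * (l : ℤ) ^ 2 →
        (7 : ℤ) ∣ (84 * (l : ℤ)) ^ 2 - 4 * x * y ∧ ¬ (7 : ℤ) ^ 2 ∣ (84 * (l : ℤ)) ^ 2 - 4 * x * y := by
      intro x y hxy
      have e1 : (84 * (l : ℤ)) ^ 2 - 4 * x * y = 7168 * (l : ℤ) ^ 2 := by rw [mul_assoc, hxy]; ring
      rw [e1]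
      refine ⟨⟨1024 * (l : ℤ) ^ 2, by ring⟩, not_sq_seven_dvd_of_not_dvd' fun h => hl7' ?_⟩
      exact ((Nat.prime_dvd_prime_iff_eq (by norm_num) hl).mp h).symm
    have h7p : Prime (7 : ℤ) := Int.prime_iff_natAbs_prime.mpr (by norm_num)
    have hnd7 : ∀ k : ℤ, ¬ (7 : ℤ) ∣ k → ∀ n : ℕ, ¬ (7 : ℤ) ∣ k * (l : ℤ) ^ n := by
      intro k hk n h
      rcases h7p.dvd_or_dvd h with h5 | h5
      · exact hk h5
      · exact hl07 ((ZMod.intCast_zmod_eq_zero_iff_dvd _ 7).mpr (h7p.dvd_of_dvd_pow h5))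
    -- a class `x` with `x y = -28ℓ²`, `7 ∤ x`, is a square mod 7 if it has a `ℚ_7`-point
    have kill : ∀ x y : ℤ, x * y = -28 * (l : ℤ) ^ 2 → ¬ (7 : ℤ) ∣ x →
        ((twoIsogenyQuartic (84 * l) x y).map (Int.castRingHom ℚ_[7])).IsSoluble →
        ∃ r : ZMod 7, ((x : ℤ) : ZMod 7) = r * r := by
      intro x y hxy hx hsol
      obtain ⟨hB1, hB2⟩ := hdisc x y hxy
      exact (isSquare_zmod_of_isSoluble_padic (p := 7) (by norm_num) hx hB1 hB2 hsol).2
    have kill' : ∀ x y : ℤ, x * y = -28 * (l : ℤ) ^ 2 → ¬ (7 : ℤ) ∣ y →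
        ((twoIsogenyQuartic (84 * l) x y).map (Int.castRingHom ℚ_[7])).IsSoluble →
        ∃ r : ZMod 7, ((y : ℤ) : ZMod 7) = r * r := by
      intro x y hxy hy hsol
      exact kill y x (by rw [mul_comm]; exact hxy) hy
        ((isSoluble_map_twoIsogenyQuartic_comm _ _ _ _).mp hsol)
    -- `d ∣ 14ℓ`
    have h0 : d ∣ -28 * (l : ℤ) ^ 2 := ⟨d', hdd'⟩
    have h1 : d ∣ (14 * (l : ℤ)) ^ 2 := h0.trans ⟨-7, by ring⟩
    have h14l : d ∣ 14 * (l : ℤ) := (hsqf.dvd_pow_iff_dvd (by norm_num)).mp h1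
    simp only [Finset.mem_union, Finset.mem_insert, Finset.mem_singleton]
    by_cases hld : (l : ℤ) ∣ d
    · obtain ⟨e, rfl⟩ := hld
      have he14 : e ∣ 14 := by
        have : (l : ℤ) * e ∣ (l : ℤ) * 14 := by rw [mul_comm (l : ℤ) 14]; exact h14l
        exact (mul_dvd_mul_iff_left hl0).mp this
      have hd'e : e * d' = -28 * l := mul_left_cancel₀ hl0 (by linear_combination (-1 : ℤ) * hdd')
      have hele : e ≤ 14 := Int.le_of_dvd (by norm_num) he14
      have hege : -14 ≤ e := by
        have := Int.le_of_dvd (by norm_num) ((Int.neg_dvd).mpr he14); linarith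
      -- `e = 1`: `ℓ` non-residue mod 7
      have hne1 : e ≠ 1 := by
        rintro rfl
        obtain ⟨r, hr⟩ := kill ((l : ℤ) * 1) d' (by linear_combination (l : ℤ) * hd'e)
          (by rw [mul_one]; exact fun h => hl07 ((ZMod.intCast_zmod_eq_zero_iff_dvd _ 7).mpr h)) (hpadic 7)
        push_cast at hr
        exact (htab r).2.2.1 (by rw [← hr]; ring)
      -- `e = 2`: `2ℓ` non-residue
      have hne2 : e ≠ 2 := by
        rintro rfl
        obtain ⟨r, hr⟩ := kill ((l : ℤ) * 2) d' (by linear_combination (l : ℤ) * hd'e)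
          (by rw [mul_comm]; exact hnd7 2 (by decide) 1 ∘ (by intro h; simpa using h)) (hpadic 7)
        push_cast at hr
        exact (htab r).2.2.2.1 (by rw [← hr]; ring)
      -- `e = -7`: `d' = 4ℓ` non-residue
      have hnem7 : e ≠ -7 := by
        rintro rfl
        have hd'1 : d' = 4 * (l : ℤ) := by linarith
        obtain ⟨r, hr⟩ := kill' ((l : ℤ) * -7) d' (by linear_combination (l : ℤ) * hd'e)
          (by rw [hd'1]; exact hnd7 4 (by decide) 1 ∘ (by intro h; simpa using h)) (hpadic 7)
        rw [hd'1] at hr; push_cast at hr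
        exact (htab r).2.2.2.2.1 (by rw [← hr])
      -- `e = -14`: `d' = 2ℓ` non-residue
      have hnem14 : e ≠ -14 := by
        rintro rfl
        have hd'1 : d' = 2 * (l : ℤ) := by linarith
        obtain ⟨r, hr⟩ := kill' ((l : ℤ) * -14) d' (by linear_combination (l : ℤ) * hd'e)
          (by rw [hd'1]; exact hnd7 2 (by decide) 1 ∘ (by intro h; simpa using h)) (hpadic 7)
        rw [hd'1] at hr; push_cast at hr
        exact (htab r).2.2.2.1 (by rw [← hr])
      -- `e = -1`: the class `-ℓ` dies at `2`
      have hnem1 : e ≠ -1 := by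
        rintro rfl
        have hd'1 : d' = 28 * (l : ℤ) := by linarith
        rw [hd'1] at hpadic
        have h2 := hpadic 2
        rw [show (l : ℤ) * -1 = -l by ring] at h2
        exact not_isSoluble_two_twoInertThree hl8 h2
      obtain ⟨k, hk⟩ := he14
      interval_cases e <;> first | (exfalso; omega) | simp
    · have hcop : IsCoprime d (l : ℤ) := ((hlp.irreducible.coprime_iff_not_dvd).mpr hld).symm
      have hd14 : d ∣ 14 := hcop.dvd_of_dvd_mul_right h14l
      have hle : d ≤ 14 := Int.le_of_dvd (by norm_num) hd14
      have hge : -14 ≤ d := by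
        have := Int.le_of_dvd (by norm_num) ((Int.neg_dvd).mpr hd14); linarith
      have hnm1 : d ≠ -1 := by
        rintro rfl
        obtain ⟨r, hr⟩ := kill (-1) d' hdd'.symm (by decide) (hpadic 7)
        push_cast at hr
        exact (htab r).1 hr.symm
      have hnm2 : d ≠ -2 := by
        rintro rfl
        obtain ⟨r, hr⟩ := kill (-2) d' hdd'.symm (by decide) (hpadic 7)
        push_cast at hr
        exact (htab r).2.1 hr.symm
      have hn7 : d ≠ 7 := by
        rintro rfl
        have hd'1 : d' = -4 * (l : ℤ) ^ 2 := by linarith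
        obtain ⟨r, hr⟩ := kill' 7 d' hdd'.symm (by rw [hd'1]; exact hnd7 (-4) (by decide) 2) (hpadic 7)
        rw [hd'1] at hr; push_cast at hr
        exact (htab r).2.2.2.2.2.1 hr.symm
      have hn14 : d ≠ 14 := by
        rintro rfl
        have hd'1 : d' = -2 * (l : ℤ) ^ 2 := by linarith
        obtain ⟨r, hr⟩ := kill' 14 d' hdd'.symm (by rw [hd'1]; exact hnd7 (-2) (by decide) 2) (hpadic 7)
        rw [hd'1] at hr; push_cast at hr
        exact (htab r).2.2.2.2.2.2 hr.symm
      obtain ⟨k, hk⟩ := hd14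
      interval_cases d <;> first | (exfalso; omega) | simp
  have hab := hab_inertTwoTwist hl.pos
  obtain ⟨k, hk⟩ := exists_card_twoIsogenySelmerGroup'_eq_two_pow hab
  have hle7 : (twoIsogenySelmerGroup' (-42 * l) (448 * l ^ 2)).card ≤ 7 :=
    (Finset.card_le_card hsub).trans
      ((Finset.card_union_le _ _).trans (Nat.add_le_add Finset.card_le_six (Finset.card_singleton _).le))
  rw [hk] at hle7 ⊢
  have hk3 : k < 3 := (Nat.pow_lt_pow_iff_right one_lt_two).mp (lt_of_le_of_lt hle7 (by norm_num))
  calc 2 ^ k ≤ 2 ^ 2 := Nat.pow_le_pow_right two_pos (by omega)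
    _ = 4 := by norm_num

end Summit.BirchSwinnertonDyer.BirchSwinnertonDyer.Theorems.GoldfeldGoodTwists

end
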